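import Literature.Topology.FourManifolds.SurfaceGroupNielsenCoreSidesAux
import Literature.Topology.FourManifolds.SurfaceGroupNielsenCoreSeparation2
import Literature.Topology.FourManifolds.SurfaceGroupNielsenCoreNoDoublePoint
import Literature.GroupTheory.CombinatorialGroupTheory.BinaryProductParity
import HarnessLib

/-!
# Nielsen's theorem, pillar CORE: the case of a double point inside one kernel

Topic `Literature/Topology/FourManifolds`.  The thirteenth case of the case analysis of a double
point `a < b` on the closed path of a potential-minimal configuration (Zieschang–Vogt–Coldewey,
LNM 835, proof of Thm. 5.3.2 with Lemma 5.3.4, in the lead's minimal-counterexample recasting):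
both cuts are interior to the kernel of ONE occurrence `k`, between its slots `sa - 1 | sa` and
`sb - 1 | sb` (`sa = slotAt k a < sb = slotAt k b`).  Then the inside consists of the kernel
slots `(k, q)`, `sa ≤ q < sb`, only; their `f`-edges to the partner occurrence `bar k` are all
crossing, so (P2) makes every partner `(bar k, n - 1 - q)` a cancelled slot, and the parity
principle (a lone crossing edge at a level is impossible) makes `[sa, sb)` closed under
`q ↦ n - 1 - q` without fixed points; hence `n` is even and `sa + sb = n`, the two middle slots
`n/2 - 1`, `n/2` of `bar k` are cancelled, one from each side by (N1), i.e. both cancellations of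
`bar k` are exactly half of it — contradicting the non-emptiness of its kernel (N2).

## References

* H. Zieschang, E. Vogt, H.-D. Coldewey, *Surfaces and Planar Discontinuous Groups*, LNM 835
  (1980), proof of Thm. 5.3.2 and Lemma 5.3.4. [ZieschangVogtColdewey1980]
-/

noncomputable section

namespace Literature.Topology.FourManifolds

open Literature.GroupTheory.CombinatorialGroupTheory Literature.GroupTheory.CombinatorialGroupTheory.CycFactors
open List

namespace SurfaceGroup

namespace Config

variable {g : ℕ} {φ : surfaceGen g → SurfaceGroup g}

section SameKernel

variable (hg : 2 ≤ g) (hI : Indecomposable φ) (hM : MarkedNontrivial φ) (κ : Config φ) (hmin : κ.IsMin)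
  (d : κ.DoublePoint)
include hg hI hM hmin

/-- **No double point with both cuts inside one kernel.**
[cite: ZieschangVogtColdewey1980, proof of Thm. 5.3.2 and Lemma 5.3.4] -/
theorem false_of_doublePoint_sameKernel {k : ℕ} (hPa : κ.PortalAt d.a k) (hPb : κ.PortalAt d.b k) :
    False := by
  have hg1 : 1 ≤ g := by omega
  have hN := κ.cycNielsen_U hg1 hI hM hmin
  have hU := κ.U_ne_nil hg1
  have hbar := κ.isPairing_bar
  have hab := d.lt
  have hk : k < κ.w.length := κ.lt_length_of_portalAt hPa (d.lt.trans d.lt_length).le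
  have hkU : k < κ.U.length := by rw [length_U]; exact hk
  have hmU : 0 < κ.U.length := by omega
  -- numerical data of the occurrence `k`
  set n := (fac κ.U k).length with hn
  set c₁ := jc κ.U (cpred κ.U k) with hc₁
  set c₂ := jc κ.U k with hc₂
  have hcc : c₁ + c₂ < n := hN.jc_add_jc_lt hU k
  have hKend : κ.Kend k = κ.Kstart k + (n - c₁ - c₂) := by
    rw [Kend, length_kernel _ _ hcc.le]
  set sa := κ.slotAt k d.a with hsa
  set sb := κ.slotAt k d.b with hsb
  have hsa' : sa = d.a - κ.Kstart k + c₁ := rfl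
  have hsb' : sb = d.b - κ.Kstart k + c₁ := rfl
  obtain ⟨ha1, ha2⟩ := hPa
  obtain ⟨hb1, hb2⟩ := hPb
  have hc₁sa : c₁ < sa := by omega
  have hsasb : sa < sb := by omega
  have hsbn : sb < n - c₂ := by omega
  -- the partner occurrence
  have hbk : κ.bar k < κ.U.length := hbar.lt k hkU
  have hbne : κ.bar k ≠ k := hbar.bar_ne k hkU
  have hnbar : (fac κ.U (κ.bar k)).length = n := hbar.length_fac_bar hkU
  -- the side function: the inside slots are the kernel slots `(k, q)`, `sa ≤ q < sb`
  let s : ℕ × ℕ → Bool := fun σ => decide (σ.1 = k ∧ sa ≤ σ.2 ∧ σ.2 < sb)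
  have hs : ∀ σ : ℕ × ℕ, s σ = true ↔ σ.1 = k ∧ sa ≤ σ.2 ∧ σ.2 < sb := fun σ => by
    simp only [s, decide_eq_true_eq]
  -- inside slots are kernel slots of `k`
  have hker : ∀ q, sa ≤ q → q < sb → IsKernelSlot κ.U (k, q) := fun q h1 h2 =>
    ⟨⟨hkU, by first | omega | (simp only; omega)⟩, by first | omega | (simp only; omega), by first | omega | (simp only; omega)⟩
  -- for kernel slots, `s` is membership of the position in `[a, b)`
  have hspos : ∀ τ : ℕ × ℕ, IsKernelSlot κ.U τ →
      (s τ = true ↔ d.a ≤ kpos κ.U τ ∧ kpos κ.U τ < d.b) := by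
    intro τ hτ
    rw [hs]
    have e1 := κ.kpos_eq τ
    have h1 := κ.Kstart_le_kpos τ
    have h2 := κ.kpos_lt_Kend hτ
    obtain ⟨⟨-, hτ2⟩, hτ3, hτ4⟩ := hτ
    constructor
    · rintro ⟨rfl, hq1, hq2⟩
      omega
    · rintro ⟨hq1, hq2⟩
      have hj : τ.1 = k :=
        κ.eq_of_Kstart_le_of_lt_Kend h1 h2 (by omega) (by omega)
      obtain ⟨τ1, τ2⟩ := τ
      simp only at hj e1 hτ2 hτ3 hτ4 h1 h2 hq1 hq2 ⊢
      subst hj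
      omega
  -- (P2): every chain has both ends on one side
  have hP2 : ∀ τ, IsKernelSlot κ.U τ → s τ = s (chainEnd κ.U κ.bar τ) := by
    intro τ hτ
    have hτ' : IsKernelSlot κ.U (chainEnd κ.U κ.bar τ) := isKernelSlot_chainEnd hN hU hbar hτ
    have hτ1 : τ.1 < κ.w.length := by rw [← length_U]; exact hτ.1.1
    have key := DoublePoint.kpos_mem_iff_of_chainEnd κ hg1 hI hM hmin d τ hτ hτ1
    rw [Bool.eq_iff_iff, hspos τ hτ, hspos _ hτ', key]
  -- MAIN CLAIM: for an inside slot `(k, q)` the reflected index `n - 1 - q` is inside and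
  -- different from `q`, and the partner `(bar k, n - 1 - q)` is cancelled
  have claim : ∀ q, sa ≤ q → q < sb →
      (sa ≤ n - 1 - q ∧ n - 1 - q < sb ∧ n - 1 - q ≠ q) ∧
        ¬ IsKernelSlot κ.U (κ.bar k, n - 1 - q) := by
    intro q hq1 hq2
    have hσk := hker q hq1 hq2
    have hσ : IsSlot κ.U (k, q) := hσk.1
    have hsσ : s (k, q) = true := (hs _).2 ⟨rfl, hq1, hq2⟩
    have hfp : fpartner κ.U κ.bar (k, q) = (κ.bar k, n - 1 - q) := rfl
    have hsτ : s (fpartner κ.U κ.bar (k, q)) = false := by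
      rw [hfp, Bool.eq_false_iff, Ne, hs]
      simp only [not_and]
      intro h
      exact absurd h hbne
    have hne : s (k, q) ≠ s (fpartner κ.U κ.bar (k, q)) := by rw [hsσ, hsτ]; decide
    have hcross : IsCrossing s (fedge κ.U κ.bar (k, q)) := isCrossing_fedge.2 hne
    refine ⟨?_, fun hker' => false_of_isCrossing_kernel_pair hP2 hσk hker' hne⟩
    by_contra hnot
    refine false_of_crossing_alone_level hN hU hbar hP2 (isEdge_fedge hσ) hcross
      ⟨(k, q), mem_fedge.2 (Or.inl rfl), rfl⟩ fun ε' hε' hc' hlev => ?_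
    -- every crossing edge at the level of `(k, q)` is `fedge (k, q)`
    have key : ∀ ρ ∈ ε'.2, s ρ = true → ε' = fedge κ.U κ.bar (k, q) := by
      intro ρ hρ hsρ
      obtain ⟨hρ1, hρ2, hρ3⟩ := (hs ρ).1 hsρ
      have hρk : IsKernelSlot κ.U ρ := by
        obtain ⟨ρ1, ρ2⟩ := ρ
        simp only at hρ1 hρ2 hρ3
        subst hρ1
        exact hker ρ2 hρ2 hρ3
      -- `ρ = (k, q)`: same level, and the reflected index is excluded by `hnot`
      have hl := hlev ρ hρ
      have hρq : ρ = (k, q) := by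
        obtain ⟨ρ1, ρ2⟩ := ρ
        simp only at hρ1 hρ2 hρ3 hl
        subst hρ1
        simp only [level] at hl
        have : ρ2 = q := by omega
        subst this
        rfl
      subst hρq
      obtain ⟨σ', hσ', h' | ⟨hkσ', h'⟩⟩ := hε'
      · subst h'
        rcases mem_fedge.1 hρ with h1 | h1
        · rw [h1]
        · rw [h1, fedge_fpartner hbar hσ']
      · subst h'
        rcases mem_cedge.1 hρ with h1 | h1
        · exact absurd (h1 ▸ hρk) hkσ'
        · exact absurd (h1 ▸ hρk) (hN.cget_spec hU hσ' hkσ').2.1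
    obtain ⟨ρ, hρ, ρ', hρ', hρρ'⟩ := hc'.exists_mem
    cases hsρ : s ρ
    · refine key ρ' hρ' ?_
      cases hsρ' : s ρ'
      · rw [hsρ, hsρ'] at hρρ'; exact absurd rfl hρρ'
      · rfl
    · exact key ρ hρ hsρ
  -- ARITHMETIC: `sa + sb = n`, `n` even, and the two middle slots of `bar k` are cancelled
  have hA := (claim sa le_rfl hsasb).1
  have hB := (claim (sb - 1) (by omega) (by omega)).1
  have hsum : sa + sb = n := by omega
  -- `n` is even: the middle index would be a fixed point
  have heven : n % 2 = 0 := by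
    by_contra hodd
    have h := (claim (n / 2) (by omega) (by omega)).1
    omega
  -- the two middle partners are cancelled
  have hm1 := (claim (n / 2 - 1) (by omega) (by omega)).2
  have hm2 := (claim (n / 2) (by omega) (by omega)).2
  -- cancellation bounds of `bar k`
  have hp1 := (hN.pair (κ.bar k)).1
  have hp2 := (hN.pair (cpred κ.U (κ.bar k))).2
  have e : cpred κ.U (κ.bar k) + 1 = κ.bar k + κ.U.length := by unfold cpred; omega
  rw [e, fac_add_length] at hp2
  have hcc' := hN.jc_add_jc_lt hU (κ.bar k)
  rw [hnbar] at hp1 hp2 hcc'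
  have hslot : ∀ j, j < n → IsSlot κ.U (κ.bar k, j) := fun j hj =>
    ⟨hbk, by show j < (fac κ.U (κ.bar k)).length; rw [hnbar]; exact hj⟩
  simp only [IsKernelSlot, hnbar, not_and, not_lt] at hm1 hm2
  have hm1' := hm1 (hslot _ (by omega))
  have hm2' := hm2 (hslot _ (by omega))
  omega

end SameKernel

end Config

end SurfaceGroup

end Literature.Topology.FourManifolds

end
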